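import Literature.Analysis.Complex.PlaneDomainUniformization
import Literature.Geometry.Kaehler.ComplexTorusHomLift
import Literature.Topology.CoveringSpaces.CoveringCompSimplyConnected
import Literature.AlgebraicTopology.Homotopy.TorusStronglyLocallyContractible
import Mathlib.Analysis.Convex.Contractible
import Mathlib.Analysis.Normed.Module.Connected
import Mathlib.LinearAlgebra.Complex.FiniteDimensional
import Mathlib.Geometry.Manifold.MFDeriv.Basic
import HarnessLib

/-!
# The unit disc is the holomorphic universal covering of a punctured complex torus

Topic `Literature/Geometry/Kaehler` (PROOF-ONLY companion of the named fact
`Complex.PlaneDomainDiscCovering`, `Literature/Analysis/Complex/PlaneDomainUniformization.lean`).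
Classical uniformization of the once- or multiply-punctured elliptic curve (Farkas–Kra, *Riemann
Surfaces*, IV.6.1 together with IV.6.3–IV.6.4: the only Riemann surfaces NOT covered by the disc are
the sphere, the plane, the punctured plane and the tori; hence every torus minus a non-empty finite set
has the disc as holomorphic universal covering).  We deduce it for the model tori
`T = ComplexTorus Φ = ℂ/Φ(ℤ^ι)` of the tree from the plane-domain uniformization fact, WITHOUT potential
theory: the covering map `π = cover Φ : ℂ → T` restricts to a holomorphic covering of `T ∖ S` by the
PLANE DOMAIN `W = ℂ ∖ π⁻¹(S)`, which is open, connected (its complement is countable) and omits at least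
two points (two lattice translates of a point over `S`); `Complex.PlaneDomainDiscCovering` covers `W`
holomorphically by the disc; and a covering of a covering whose top space is simply connected is a
covering (`IsCoveringMap.comp_of_simplyConnectedSpace`, the base `T ∖ S` being path connected and
strongly locally contractible).

* `ComplexTorus.countable_cover_preimage`, `isConnected_cover_preimage_compl`,
  `exists_two_not_mem_cover_preimage_compl` — the plane domain `ℂ ∖ π⁻¹(S)`;
* `ComplexTorus.isCoveringMap_restrictPreimage_cover`, `mdifferentiable_restrictPreimage_cover` —
  `π : ℂ ∖ π⁻¹(S) → T ∖ S` is a holomorphic covering;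
* **`ComplexTorus.exists_disc_covering_compl_finite`** — for `S ⊆ T` finite and non-empty there is a
  holomorphic covering map `𝔻 → T ∖ S` of the punctured torus by the unit disc, onto, CONDITIONAL on
  `Complex.PlaneDomainDiscCovering` (taken as a hypothesis; GAP G-L4t8g7-1 of the abc-iut cell,
  programme «UNIF-G1P»).  `𝔻` and `T ∖ S` are the open-subset Riemann surfaces
  `↥Complex.unitDiscOpens'`-free: we use `(⟨ball 0 1, isOpen_ball⟩ : Opens ℂ)` and
  `(⟨Sᶜ, _⟩ : Opens (ComplexTorus Φ))` with Mathlib's `Opens.instChartedSpace`.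

No definitions; nothing here is specific to IUT.  Consumers: the universal-covering hypotheses
(`IsAutHolDisc`) of [AbsTopIII] Cor. 2.4 / 2.7 at the genuine once-punctured elliptic curves
(`Literature/AnabelianGeometry/AbsoluteAnabelian/`).

## References
* [FarkasKra1992] H. M. Farkas, I. Kra, *Riemann Surfaces*, 2nd ed., IV.6.1, IV.6.3–IV.6.4.
* [FisherHubbardWittner1988] Proc. AMS 104 (1988) 413–418 (the plane-domain input).
-/

noncomputable section

open Set Function Metric TopologicalSpace
open scoped Manifold Topology ContDiff

namespace Literature.Geometry.Kaehler

namespace ComplexTorus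

variable {ι : Type} [Fintype ι] (Φ : (ι → ℝ) ≃L[ℝ] ℂ)

/-! ### Holomorphy of maps between open subsets (local copies of standard facts) -/

/-- Differentiability of a map restricted to an open subset (domain side). [folklore] -/
private theorem mdifferentiableAt_subtype_iff' {M : Type} [TopologicalSpace M] [ChartedSpace ℂ M]
    {M' : Type} [TopologicalSpace M'] [ChartedSpace ℂ M'] {U : Opens M} {f : M → M'} {x : U} :
    MDifferentiableAt 𝓘(ℂ, ℂ) 𝓘(ℂ, ℂ) (fun x : U => f x) x ↔ MDifferentiableAt 𝓘(ℂ, ℂ) 𝓘(ℂ, ℂ) f x :=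
  ((differentiableWithinAt_localInvariantProp (I := 𝓘(ℂ, ℂ)) (I' := 𝓘(ℂ, ℂ))).liftPropAt_iff_comp_subtype_val
    _ _).symm

/-- Differentiability of a map into an open subset (codomain side). [folklore] -/
private theorem mdifferentiableAt_subtypeVal_comp_iff' {M : Type} [TopologicalSpace M] [ChartedSpace ℂ M]
    {M' : Type} [TopologicalSpace M'] [ChartedSpace ℂ M'] (U : Opens M') (f : M → U) (x : M) :
    MDifferentiableAt 𝓘(ℂ, ℂ) 𝓘(ℂ, ℂ) (Subtype.val ∘ f) x ↔ MDifferentiableAt 𝓘(ℂ, ℂ) 𝓘(ℂ, ℂ) f x :=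
  ChartedSpace.liftPropWithinAt_subtypeVal_comp_iff ..

/-- A map between open subsets whose composite with the inclusions is, at every point of the source,
a differentiable map of the ambient manifolds is holomorphic. [folklore] -/
private theorem mdifferentiable_opens_of_val_eq_at {M : Type} [TopologicalSpace M] [ChartedSpace ℂ M]
    {M' : Type} [TopologicalSpace M'] [ChartedSpace ℂ M'] {U : Opens M} {V : Opens M'} {g : M → M'}
    (e : U → V) (he : ∀ x : U, (e x : M') = g x)
    (hg : ∀ x : U, MDifferentiableAt 𝓘(ℂ, ℂ) 𝓘(ℂ, ℂ) g x) : MDifferentiable 𝓘(ℂ, ℂ) 𝓘(ℂ, ℂ) e := by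
  intro x
  rw [← mdifferentiableAt_subtypeVal_comp_iff']
  have : (Subtype.val ∘ e) = fun x : U => g x := funext fun x => he x
  rw [this, mdifferentiableAt_subtype_iff']
  exact hg x

/-! ### The plane domain `ℂ ∖ π⁻¹(S)` over a finite set `S` of the torus -/

/-- A fibre of the covering map `π : ℂ → ℂ/Φ(ℤ^ι)` is a translate of the lattice `Φ(ℤ^ι)`, hence
countable; so is the preimage of any countable set. [cite: LangeBirkenhake1992, Lemma 1.1.3] -/
theorem countable_cover_preimage {S : Set (ComplexTorus Φ)} (hS : S.Countable) :
    (cover Φ ⁻¹' S).Countable := by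
  have hfib : ∀ t : ComplexTorus Φ, (cover Φ ⁻¹' {t}).Countable := by
    intro t
    by_cases ht : (cover Φ ⁻¹' {t}).Nonempty
    · obtain ⟨z₀, hz₀⟩ := ht
      have hz₀' : cover Φ z₀ = t := hz₀
      refine (Set.countable_range fun n : ι → ℤ => z₀ + latticeVec Φ n).mono ?_
      intro z hz
      have hz' : cover Φ z = t := hz
      have h0 : cover Φ (z - z₀) = 0 := by rw [cover_sub, hz', hz₀', sub_self]
      obtain ⟨n, hn⟩ := (cover_eq_zero_iff Φ (z - z₀)).1 h0
      refine ⟨n, ?_⟩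
      show z₀ + latticeVec Φ n = z
      rw [← hn, add_sub_cancel]
    · rw [Set.not_nonempty_iff_eq_empty.1 ht]
      exact Set.countable_empty
  have : cover Φ ⁻¹' S = ⋃ t ∈ S, cover Φ ⁻¹' {t} := by
    ext z
    simp
  rw [this]
  exact hS.biUnion fun t _ => hfib t

/-- The preimage `ℂ ∖ π⁻¹(S)` of the complement of a countable subset of the torus is path connected
(the complement of a countable subset of the plane, of real dimension `2 > 1`).
[cite: FarkasKra1992, IV.6.1] -/
theorem isPathConnected_cover_preimage_compl {S : Set (ComplexTorus Φ)}
    (hS : S.Countable) : IsPathConnected (cover Φ ⁻¹' Sᶜ) := by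
  rw [Set.preimage_compl]
  have hrank : 1 < Module.rank ℝ ℂ := by rw [Complex.rank_real_complex]; norm_num
  exact Set.Countable.isPathConnected_compl_of_one_lt_rank hrank (countable_cover_preimage Φ hS)

/-- The preimage `ℂ ∖ π⁻¹(S)` of the complement of a countable subset of the torus is connected.
[cite: FarkasKra1992, IV.6.1] -/
theorem isConnected_cover_preimage_compl {S : Set (ComplexTorus Φ)} (hS : S.Countable) :
    IsConnected (cover Φ ⁻¹' Sᶜ) :=
  (isPathConnected_cover_preimage_compl Φ hS).isConnected

/-- The complement of a countable subset of the torus is path connected (image of the path connected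
plane domain `ℂ ∖ π⁻¹(S)` under the covering map). [cite: FarkasKra1992, IV.6.1] -/
theorem isPathConnected_compl_of_countable {S : Set (ComplexTorus Φ)}
    (hS : S.Countable) : IsPathConnected Sᶜ := by
  have himage : cover Φ '' (cover Φ ⁻¹' Sᶜ) = Sᶜ := Set.image_preimage_eq _ (cover_surjective Φ)
  rw [← himage]
  exact (isPathConnected_cover_preimage_compl Φ hS).image (continuous_cover Φ)

/-- If `S` is non-empty, the plane domain `ℂ ∖ π⁻¹(S)` omits two distinct points (two lattice
translates of a point over `S`; the index type `ι` is non-empty since `ℝ^ι ≅ ℂ`).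
[cite: FarkasKra1992, IV.6.1] -/
theorem exists_two_not_mem_cover_preimage_compl {S : Set (ComplexTorus Φ)} (hS : S.Nonempty) :
    ∃ a b : ℂ, a ≠ b ∧ a ∉ cover Φ ⁻¹' Sᶜ ∧ b ∉ cover Φ ⁻¹' Sᶜ := by
  obtain ⟨s, hs⟩ := hS
  obtain ⟨z₀, hz₀⟩ := cover_surjective Φ s
  -- `ι` is non-empty: otherwise `ℝ^ι = 0 ≅ ℂ`, absurd
  have hι : Nonempty ι := by
    by_contra h
    rw [not_nonempty_iff] at h
    have h1 : (Φ.symm 1 : ι → ℝ) = Φ.symm 0 := Subsingleton.elim _ _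
    exact one_ne_zero (Φ.symm.injective h1)
  classical
  obtain ⟨i⟩ := hι
  let n : ι → ℤ := Pi.single i 1
  have hn : latticeVec Φ n ≠ 0 := by
    intro h
    have h' : (fun j => (n j : ℝ)) = 0 := by
      have := congrArg Φ.symm h
      rwa [latticeVec, ContinuousLinearEquiv.symm_apply_apply, map_zero] at this
    have := congrFun h' i
    simp only [n, Pi.single_eq_same, Int.cast_one, Pi.zero_apply] at this
    exact one_ne_zero this
  refine ⟨z₀, z₀ + latticeVec Φ n, fun h => hn (by linear_combination h.symm), ?_, ?_⟩
  · simp [hz₀, hs]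
  · simp [cover_add_latticeVec, hz₀, hs]

/-! ### `π : ℂ ∖ π⁻¹(S) → T ∖ S` is a holomorphic covering -/

/-- The restriction of the covering map `π : ℂ → T` over `T ∖ S` is a covering map.
[cite: LangeBirkenhake1992, Lemma 1.1.3] -/
theorem isCoveringMap_restrictPreimage_cover (S : Set (ComplexTorus Φ)) :
    IsCoveringMap (Sᶜ.restrictPreimage (cover Φ)) :=
  (isCoveringMap_cover (Φ := Φ)).restrictPreimage Sᶜ

/-- The restriction `π : ℂ ∖ π⁻¹(S) → T ∖ S` (`x ↦ ⟨π x, _⟩`, i.e. `Sᶜ.restrictPreimage (cover Φ)`), as a map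
of the open-subset Riemann surfaces, is holomorphic (`S` closed, e.g. finite).
[cite: LangeBirkenhake1992, Lemma 1.1.3] -/
theorem mdifferentiable_restrictPreimage_cover {S : Set (ComplexTorus Φ)} (hS : IsClosed S) :
    MDifferentiable 𝓘(ℂ, ℂ) 𝓘(ℂ, ℂ)
      (fun x : (⟨cover Φ ⁻¹' Sᶜ, (hS.isOpen_compl).preimage (continuous_cover Φ)⟩ : Opens ℂ) =>
        (⟨cover Φ (x : ℂ), x.2⟩ : (⟨Sᶜ, hS.isOpen_compl⟩ : Opens (ComplexTorus Φ)))) :=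
  mdifferentiable_opens_of_val_eq_at (g := cover Φ) _ (fun _ => rfl)
    fun x => mdifferentiable_cover (𝕜 := ℂ) Φ (x : ℂ)

/-! ### The disc covers the punctured torus -/

/-- The open unit disc, as an open subset of `ℂ`, is simply connected (it is convex). [folklore] -/
private theorem simplyConnectedSpace_ball :
    SimplyConnectedSpace (⟨ball (0 : ℂ) 1, isOpen_ball⟩ : Opens ℂ) := by
  haveI : ContractibleSpace (ball (0 : ℂ) 1) :=
    (convex_ball (0 : ℂ) 1).contractibleSpace ⟨0, mem_ball_self one_pos⟩
  exact SimplyConnectedSpace.ofContractible _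

/-- **The unit disc is the holomorphic universal covering of a punctured complex torus**
(Farkas–Kra IV.6: tori minus a non-empty finite set are uniformized by the disc), CONDITIONAL on the
plane-domain uniformization fact `Complex.PlaneDomainDiscCovering`: for `T = ℂ/Φ(ℤ^ι)` and
`S ⊆ T` finite and non-empty there is a holomorphic covering map from the open unit disc ONTO the
Riemann surface `T ∖ S`.  Route: disc `→ ℂ ∖ π⁻¹(S)` (the fact) `→ T ∖ S` (restriction of `π`), a
covering by `IsCoveringMap.comp_of_simplyConnectedSpace`. [cite: FarkasKra1992, IV.6.1] -/
theorem exists_disc_covering_compl_finite (H : Complex.PlaneDomainDiscCovering)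
    {S : Set (ComplexTorus Φ)} (hS : S.Finite) (hne : S.Nonempty) :
    ∃ p : (⟨ball (0 : ℂ) 1, isOpen_ball⟩ : Opens ℂ) →
        (⟨Sᶜ, hS.isClosed.isOpen_compl⟩ : Opens (ComplexTorus Φ)),
      IsCoveringMap p ∧ Function.Surjective p ∧ MDifferentiable 𝓘(ℂ, ℂ) 𝓘(ℂ, ℂ) p := by
  classical
  -- the plane domain `W = ℂ ∖ π⁻¹(S)` and its disc covering from the fact
  set W : Set ℂ := cover Φ ⁻¹' Sᶜ with hW
  have hWo : IsOpen W := (hS.isClosed.isOpen_compl).preimage (continuous_cover Φ)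
  obtain ⟨f, hf, hsurj, hmaps, hcov⟩ :=
    H W hWo (isConnected_cover_preimage_compl Φ hS.countable)
      (exists_two_not_mem_cover_preimage_compl Φ hne)
  -- the two open-subset Riemann surfaces and the two maps
  let D : Opens ℂ := ⟨ball (0 : ℂ) 1, isOpen_ball⟩
  let Wo : Opens ℂ := ⟨W, hWo⟩
  let X : Opens (ComplexTorus Φ) := ⟨Sᶜ, hS.isClosed.isOpen_compl⟩
  let π₁ : D → Wo := hmaps.restrict
  let q : Wo → X := fun x => ⟨cover Φ (x : ℂ), x.2⟩
  have hπ₁ : IsCoveringMap π₁ := hcov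
  have hq : IsCoveringMap q := by exact isCoveringMap_restrictPreimage_cover Φ S
  -- topological hypotheses for the composition lemma
  haveI : SimplyConnectedSpace D := simplyConnectedSpace_ball
  haveI : LocallyPathConnectedSpace D := isOpen_ball.locallyPathConnectedSpace
  haveI : StronglyLocallyContractibleSpace X :=
    Literature.AlgebraicTopology.Homotopy.stronglyLocallyContractibleSpace_compl_finite_pi_addCircle
      one_ne_zero hS
  haveI : PathConnectedSpace X :=
    isPathConnected_iff_pathConnectedSpace.mp (isPathConnected_compl_of_countable Φ hS.countable)
  -- the composite `𝔻 → ℂ ∖ π⁻¹(S) → T ∖ S`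
  refine ⟨q ∘ π₁, hπ₁.comp_of_simplyConnectedSpace hq, ?_, ?_⟩
  · intro t
    obtain ⟨w, hw⟩ := cover_surjective Φ (t : ComplexTorus Φ)
    have hwW : w ∈ W := by
      show cover Φ w ∈ Sᶜ
      rw [hw]; exact t.2
    obtain ⟨x, hx, hxw⟩ := hsurj hwW
    refine ⟨⟨x, hx⟩, Subtype.ext ?_⟩
    show cover Φ (f x) = t
    rw [hxw, hw]
  · refine mdifferentiable_opens_of_val_eq_at (g := fun z => cover Φ (f z)) _ (fun _ => rfl) fun x => ?_
    have hfx : DifferentiableAt ℂ f (x : ℂ) := hf.differentiableAt (isOpen_ball.mem_nhds x.2)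
    exact (mdifferentiable_cover (𝕜 := ℂ) Φ (f x)).comp (x : ℂ) hfx.mdifferentiableAt

end ComplexTorus

end Literature.Geometry.Kaehler

end
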